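import Literature.AlgebraicGeometry.Resolution.FineModels
import Mathlib.RingTheory.Polynomial.Vieta
import Mathlib.FieldTheory.IsAlgClosed.Basic
import HarnessLib

/-!
# Conjugates bounded by `r` ⇒ coefficients of the minimal polynomial bounded by powers of `r`

Topic: `Literature/AlgebraicGeometry/Resolution` (valued function fields; models over valuation
rings). Groundwork for the algebraization step of M. Temkin, *Inseparable local uniformization*,
J. Algebra 373 (2013) = arXiv:0804.1554v3, Thm. 3.3.1 (tree: the named fact
`Temkin2013RelativeCurveSmoothFibre`). In the algebraic proof the `K`-rational model is refined by
the coefficients of minimal polynomials (over the base function field `F`) of elements `w` of the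
finite extension `L ⊇ F` (`FineModels.lean`: an element integral over `O_F = F ∩ O_V` becomes
integral over the refined model), and the same coefficients must afterwards be shown to lie in the
`m°`-side étale chart, which needs a BOUND on their values. Both are read off the conjugates:
inside one algebraically closed valued field `(Ω, V)` the conjugates of `w` over `F` are the
`σ w`, `σ : L →ₐ[F] Ω`, i.e. the roots of the minimal polynomial, and by Vieta the `i`-th
coefficient is `±` the elementary symmetric function of degree `deg − i` in them; the valuation
being non-archimedean, `|e_j(ρ₁, …, ρ_d)| ≤ (max |ρ_ν|)^j`.

* `valuation_sum_multiset_le`, `valuation_esymm_le` — ultrametric bounds for sums and for the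
  elementary symmetric functions of a multiset all of whose members have value `≤ r` — PROVED;
* `valuation_coeff_le_of_splits` — for a monic split polynomial over `Ω` whose roots have value
  `≤ r`, `|coeff i| ≤ r ^ (deg − i)` — PROVED;
* `valuation_coeff_minpoly_le_of_forall_aroots` — the same for the minimal polynomial over any
  field `E → Ω` of an element of `Ω`, the hypothesis being on its roots in `Ω` — PROVED;
* `valuation_coeff_minpoly_le_of_forall_algHom`, `coeff_minpoly_mem_of_forall_algHom`,
  `isIntegral_of_forall_algHom_mem` — **for `L/F` algebraic realized in `Ω` algebraically closed:
  if `|σ w| ≤ r` for every `F`-embedding `σ : L → Ω` then `|(minpoly F w)_i| ≤ r ^ (deg − i)`; if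
  all `σ w ∈ O_V` then the minimal polynomial has coefficients in `O_F = F ∩ O_V` and `w` is
  integral over (the image in `L` of) `O_F`** — PROVED;
* `isIntegral_div_of_forall_algHom_le` — scaling: `|σ w| ≤ |c|` for all `σ` (`c ∈ F`) makes `w/c`
  integral over `O_F` — PROVED;
* `mem_nrIn_map_of_forall_coeff_minpoly_mem`, `exists_finset_coeff_minpoly_of_forall_algHom_mem`,
  `exists_refine_mem_nrIn_of_forall_algHom_mem` — **controlled refinement of an affine normalized
  model** (`FineModels.lean` with EXPLICIT generators): adjoining the coefficients of `minpoly F w`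
  (which lie in `O_F`) to the model `A` gives `A′ ≥ A` with `w ∈ Nr_L(A′)` — PROVED.

All statements are [folklore] (Vieta + the ultrametric inequality; N. Bourbaki, *Alg. comm.* VI §8
no. 6 for the use: integrality over a valuation ring is tested on the conjugates); no definitions,
no named facts.

## Sources

* M. Temkin, arXiv:0804.1554v3, proof of Thm. 3.3.1, Step 3 (p. 45) (the use: refining the
  model by `K`-rational functions built from conjugates — there by norms).
* N. Bourbaki, *Algèbre commutative* VI §8 no. 6 (integral closure of a valuation ring in an
  algebraic extension).
-/

noncomputable section

open Polynomial

namespace Literature.AlgebraicGeometry.Resolution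

universe u

variable {Ω : Type u} [Field Ω] (V : ValuationSubring Ω)

/-! ### Ultrametric bounds for sums, products and elementary symmetric functions -/

section Ultrametric

/-- A multiset sum of elements of value `≤ g` has value `≤ g`. [folklore] -/
theorem valuation_sum_multiset_le (t : Multiset Ω) {g : V.ValueGroup}
    (h : ∀ a ∈ t, V.valuation a ≤ g) : V.valuation t.sum ≤ g := by
  induction t using Multiset.induction_on with
  | empty => rw [Multiset.sum_zero, map_zero]; exact zero_le
  | cons a t ih =>
    rw [Multiset.sum_cons]
    exact Valuation.map_add_le _ (h a (Multiset.mem_cons_self a t))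
      (ih fun b hb => h b (Multiset.mem_cons_of_mem hb))

/-- A multiset product of elements of value `≤ r` has value `≤ r ^ card`. [folklore] -/
theorem valuation_multiset_prod_le (t : Multiset Ω) {r : V.ValueGroup}
    (h : ∀ a ∈ t, V.valuation a ≤ r) : V.valuation t.prod ≤ r ^ Multiset.card t := by
  rw [map_multiset_prod, ← Multiset.card_map V.valuation t]
  refine Multiset.prod_le_pow_card _ r fun x hx => ?_
  obtain ⟨a, ha, rfl⟩ := Multiset.mem_map.mp hx
  exact h a ha

/-- **Elementary symmetric functions of small elements are small**: if every member of the
multiset `s` has value `≤ r` then `|e_m(s)| ≤ r ^ m`. [folklore] -/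
theorem valuation_esymm_le (s : Multiset Ω) {r : V.ValueGroup} (hs : ∀ ρ ∈ s, V.valuation ρ ≤ r)
    (m : ℕ) : V.valuation (s.esymm m) ≤ r ^ m := by
  unfold Multiset.esymm
  refine valuation_sum_multiset_le V _ fun a ha => ?_
  obtain ⟨t, ht, rfl⟩ := Multiset.mem_map.mp ha
  obtain ⟨hts, htc⟩ := Multiset.mem_powersetCard.mp ht
  rw [← htc]
  exact valuation_multiset_prod_le V t fun b hb => hs b (Multiset.mem_of_le hts hb)

end Ultrametric

/-! ### Coefficients of a split monic polynomial -/

section Split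

/-- **Vieta bound**: for a monic split polynomial over `Ω` all of whose roots have value `≤ r`,
the `i`-th coefficient has value `≤ r ^ (deg − i)`. [folklore] -/
theorem valuation_coeff_le_of_splits {p : Polynomial Ω} (hmon : p.Monic) (hsp : p.Splits)
    {r : V.ValueGroup} (hr : ∀ ρ ∈ p.roots, V.valuation ρ ≤ r) (i : ℕ) :
    V.valuation (p.coeff i) ≤ r ^ (p.natDegree - i) := by
  by_cases hi : i ≤ p.natDegree
  · rw [Polynomial.coeff_eq_esymm_roots_of_splits hsp hi, hmon.leadingCoeff, one_mul, map_mul,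
      map_pow, Valuation.map_neg, map_one, one_pow, one_mul]
    exact valuation_esymm_le V p.roots hr _
  · rw [Polynomial.coeff_eq_zero_of_natDegree_lt (not_le.mp hi), map_zero]
    exact zero_le

/-- The Vieta bound for the minimal polynomial over a field `E → Ω` of an element of `Ω`, the
hypothesis being on its roots in `Ω` (the conjugates). [folklore] -/
theorem valuation_coeff_minpoly_le_of_forall_aroots [IsAlgClosed Ω] {E : Type*} [Field E]
    [Algebra E Ω] {g : Ω} (hg : IsIntegral E g) {r : V.ValueGroup}
    (hr : ∀ ρ ∈ (minpoly E g).aroots Ω, V.valuation ρ ≤ r) (i : ℕ) :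
    V.valuation (algebraMap E Ω ((minpoly E g).coeff i)) ≤ r ^ ((minpoly E g).natDegree - i) := by
  have hmon : ((minpoly E g).map (algebraMap E Ω)).Monic := (minpoly.monic hg).map _
  have h := valuation_coeff_le_of_splits V hmon (IsAlgClosed.splits _) hr i
  rwa [Polynomial.coeff_map, Polynomial.natDegree_map] at h

end Split

/-! ### Conjugates as embeddings: the bound and integrality over `O_F` -/

section Embeddings

variable [IsAlgClosed Ω] {F L : Type*} [Field F] [Field L] [Algebra F L] [Algebra F Ω]
  [Algebra.IsAlgebraic F L]

/-- Every root in `Ω` of the minimal polynomial of `w ∈ L` over `F` is `σ w` for an `F`-embedding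
`σ : L → Ω` (`Ω` algebraically closed, `L/F` algebraic; no embedding `L → Ω` needs to be fixed —
in the applications `L ⊆ Ω` and the inclusion is one of the `σ`). [folklore] -/
theorem exists_algHom_apply_eq_of_mem_aroots (w : L) {ρ : Ω} (hρ : ρ ∈ (minpoly F w).aroots Ω) :
    ∃ σ : L →ₐ[F] Ω, σ w = ρ := by
  classical
  have hmem : ρ ∈ (minpoly F w).rootSet Ω := by
    rw [Polynomial.rootSet_def, Finset.mem_coe, Multiset.mem_toFinset]
    exact hρ
  rw [← Algebra.IsAlgebraic.range_eval_eq_rootSet_minpoly Ω w] at hmem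
  exact hmem

/-- Conversely `σ w` is a root of the minimal polynomial. [folklore] -/
theorem algHom_apply_mem_aroots (w : L) (σ : L →ₐ[F] Ω) : σ w ∈ (minpoly F w).aroots Ω := by
  classical
  have hmem : σ w ∈ (minpoly F w).rootSet Ω := by
    rw [← Algebra.IsAlgebraic.range_eval_eq_rootSet_minpoly Ω w]
    exact ⟨σ, rfl⟩
  rwa [Polynomial.rootSet_def, Finset.mem_coe, Multiset.mem_toFinset] at hmem

/-- **Conjugate bound ⇒ coefficient bound.** If `|σ w| ≤ r` for every `F`-embedding
`σ : L → Ω`, then the `i`-th coefficient of the minimal polynomial of `w` over `F` has value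
`≤ r ^ (deg − i)` in `Ω`. [folklore] -/
theorem valuation_coeff_minpoly_le_of_forall_algHom (w : L) {r : V.ValueGroup}
    (h : ∀ σ : L →ₐ[F] Ω, V.valuation (σ w) ≤ r) (i : ℕ) :
    V.valuation (algebraMap F Ω ((minpoly F w).coeff i)) ≤ r ^ ((minpoly F w).natDegree - i) := by
  have hw : IsIntegral F w := Algebra.IsIntegral.isIntegral w
  have hmon : ((minpoly F w).map (algebraMap F Ω)).Monic := (minpoly.monic hw).map _
  have hr : ∀ ρ ∈ ((minpoly F w).map (algebraMap F Ω)).roots, V.valuation ρ ≤ r := by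
    intro ρ hρ
    obtain ⟨σ, rfl⟩ := exists_algHom_apply_eq_of_mem_aroots (F := F) w hρ
    exact h σ
  have hle := valuation_coeff_le_of_splits V hmon (IsAlgClosed.splits _) hr i
  rwa [Polynomial.coeff_map, Polynomial.natDegree_map] at hle

/-- **All conjugates in `O_V` ⇒ the minimal polynomial has coefficients in `O_V`** (as elements
of `Ω`). [folklore] -/
theorem coeff_minpoly_mem_of_forall_algHom (w : L) (h : ∀ σ : L →ₐ[F] Ω, σ w ∈ V) (i : ℕ) :
    algebraMap F Ω ((minpoly F w).coeff i) ∈ V := by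
  rw [← V.valuation_le_one_iff]
  have hle := valuation_coeff_minpoly_le_of_forall_algHom V w (r := 1)
    (fun σ => (V.valuation_le_one_iff _).mpr (h σ)) i
  rwa [one_pow] at hle

/-- The same, phrased with the valuation ring `O_F = F ∩ O_V` of `F`. [folklore] -/
theorem coeff_minpoly_mem_comap_of_forall_algHom (w : L) (h : ∀ σ : L →ₐ[F] Ω, σ w ∈ V)
    (i : ℕ) : (minpoly F w).coeff i ∈ V.comap (algebraMap F Ω) :=
  ValuationSubring.mem_comap.mpr (coeff_minpoly_mem_of_forall_algHom V w h i)

/-- **All conjugates in `O_V` ⇒ integral over `O_F`**, in the form consumed by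
`FineModels.lean` (`IsIntegral` over the image of `O_F` in `L`): if `σ w ∈ O_V` for every
`F`-embedding `σ : L → Ω` then `w` is integral over the subring `O_F ⊆ L`,
`O_F = F ∩ O_V = V.comap (algebraMap F Ω)`. [folklore] -/
theorem isIntegral_of_forall_algHom_mem (w : L) (h : ∀ σ : L →ₐ[F] Ω, σ w ∈ V) :
    IsIntegral ((V.comap (algebraMap F Ω)).toSubring.map (algebraMap F L)) w := by
  have hw : IsIntegral F w := Algebra.IsIntegral.isIntegral w
  refine isIntegral_of_monic_of_coeff_mem _ ((minpoly.monic hw).map (algebraMap F L))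
    (fun i => ?_) ?_
  · rw [Polynomial.coeff_map]
    exact Subring.mem_map.mpr ⟨_, coeff_minpoly_mem_comap_of_forall_algHom V w h i, rfl⟩
  · rw [Polynomial.eval_map, ← Polynomial.aeval_def, minpoly.aeval]

/-- **Scaling.** For `c ∈ F`, `c ≠ 0`: if `|σ w| ≤ |c|` for all `σ` then `w / c` has all its
conjugates in `O_V`, hence is integral over `O_F` — the form in which the model is refined by
"a fixed function divided by the radius". [folklore] -/
theorem isIntegral_div_of_forall_algHom_le (w : L) {c : F} (hc : c ≠ 0)
    (h : ∀ σ : L →ₐ[F] Ω, V.valuation (σ w) ≤ V.valuation (algebraMap F Ω c)) :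
    IsIntegral ((V.comap (algebraMap F Ω)).toSubring.map (algebraMap F L))
      (w / algebraMap F L c) := by
  refine isIntegral_of_forall_algHom_mem V _ fun σ => ?_
  have hc' : V.valuation (algebraMap F Ω c) ≠ 0 := by
    rw [Ne, Valuation.zero_iff]
    exact (_root_.map_ne_zero _).mpr hc
  rw [map_div₀, AlgHom.commutes, ← V.valuation_le_one_iff, map_div₀]
  exact div_le_one_of_le₀ (h σ) zero_le

end Embeddings

/-! ### Controlled refinement: the coefficients of the minimal polynomial as new generators -/

section Refinement

variable [IsAlgClosed Ω] {K L : Type u} [Field K] [Field L] [Algebra K L] [Algebra K Ω]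
  [Algebra.IsAlgebraic K L]

omit [IsAlgClosed Ω] [Algebra K Ω] [Algebra.IsAlgebraic K L] in
/-- An element whose minimal polynomial over `K` has all its coefficients in a subring `A″ ⊆ K`
lies in the `L`-normalization `Nr_L(A″)` of (the image of) `A″`. [folklore] -/
theorem mem_nrIn_map_of_forall_coeff_minpoly_mem {w : L} (hw : IsIntegral K w) (A'' : Subring K)
    (h : ∀ i, (minpoly K w).coeff i ∈ A'') : w ∈ nrIn (A''.map (algebraMap K L)) := by
  refine mem_nrIn_iff.mpr (isIntegral_of_monic_of_coeff_mem _
    ((minpoly.monic hw).map (algebraMap K L)) (fun i => ?_) ?_)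
  · rw [Polynomial.coeff_map]
    exact Subring.mem_map.mpr ⟨_, h i, rfl⟩
  · rw [Polynomial.eval_map, ← Polynomial.aeval_def, minpoly.aeval]

omit [IsAlgClosed Ω] [Algebra K Ω] [Algebra.IsAlgebraic K L] in
/-- The finitely many coefficients: if the subring contains `(minpoly K w)_i` for
`i ≤ deg`, it contains all coefficients. [folklore] -/
theorem forall_coeff_minpoly_mem_of_subset [DecidableEq K] (w : L) (A'' : Subring K)
    (h : (↑((Finset.range ((minpoly K w).natDegree + 1)).image fun i => (minpoly K w).coeff i) :
      Set K) ⊆ A'') (i : ℕ) : (minpoly K w).coeff i ∈ A'' := by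
  by_cases hi : i ≤ (minpoly K w).natDegree
  · exact h (Finset.mem_coe.mpr (Finset.mem_image.mpr
      ⟨i, Finset.mem_range.mpr (Nat.lt_succ_of_le hi), rfl⟩))
  · rw [Polynomial.coeff_eq_zero_of_natDegree_lt (not_le.mp hi)]
    exact A''.zero_mem

/-- **Controlled refinement, model-free form.** If all `K`-conjugates of `w ∈ L` lie in `O_V`,
then the finite set `s′` of coefficients of `minpoly K w` lies in `O_K = K ∩ O_V`, and for EVERY
subring `A″ ⊇ s′` of `K` one has `w ∈ Nr_L(A″)`. (Contrast `FineModels.exists_fine_generators`,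
where the generators are not explicit.) [folklore] -/
theorem exists_finset_coeff_minpoly_of_forall_algHom_mem [DecidableEq K] (w : L)
    (h : ∀ σ : L →ₐ[K] Ω, σ w ∈ V) :
    ∃ s' : Finset K, (↑s' : Set K) ⊆ (V.comap (algebraMap K Ω) : Set K) ∧
      (∀ c ∈ s', ∃ i, c = (minpoly K w).coeff i) ∧
      ∀ A'' : Subring K, (↑s' : Set K) ⊆ A'' → w ∈ nrIn (A''.map (algebraMap K L)) := by
  refine ⟨(Finset.range ((minpoly K w).natDegree + 1)).image fun i => (minpoly K w).coeff i,
    fun c hc => ?_, fun c hc => ?_, fun A'' hA'' => ?_⟩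
  · obtain ⟨i, -, rfl⟩ := Finset.mem_image.mp (Finset.mem_coe.mp hc)
    exact coeff_minpoly_mem_comap_of_forall_algHom V w h i
  · obtain ⟨i, -, rfl⟩ := Finset.mem_image.mp hc
    exact ⟨i, rfl⟩
  · exact mem_nrIn_map_of_forall_coeff_minpoly_mem (Algebra.IsIntegral.isIntegral w) A''
      (forall_coeff_minpoly_mem_of_subset w A'' hA'')

/-- **Controlled refinement of an affine normalized model.** Let `O = K ∩ O_V` (`hO`), `A` an
affine normalized model of `K°` over `R₀`, and `w ∈ L` with all its `K`-conjugates in `O_V`.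
Then refining `A` by the coefficients of `minpoly K w` gives an affine normalized model `A′ ≥ A`
containing those coefficients, with `w ∈ Nr_L(A′)`. [folklore] -/
theorem exists_refine_mem_nrIn_of_forall_algHom_mem {O : ValuationSubring K}
    (hO : V.comap (algebraMap K Ω) = O) {R₀ A : Subring K} (hA : IsAffineNormalizedModel O R₀ A)
    (w : L) (h : ∀ σ : L →ₐ[K] Ω, σ w ∈ V) :
    ∃ A' : Subring K, A ≤ A' ∧ IsAffineNormalizedModel O R₀ A' ∧
      (∀ i, (minpoly K w).coeff i ∈ A') ∧ w ∈ nrIn (A'.map (algebraMap K L)) := by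
  classical
  set s' : Finset K := (Finset.range ((minpoly K w).natDegree + 1)).image
    fun i => (minpoly K w).coeff i with hs'
  have hs'O : (↑s' : Set K) ⊆ (O : Set K) := by
    intro c hc
    obtain ⟨i, -, rfl⟩ := Finset.mem_image.mp (Finset.mem_coe.mp hc)
    have hi := coeff_minpoly_mem_comap_of_forall_algHom V w h i
    rw [hO] at hi
    exact hi
  obtain ⟨A', hAA', hA', hs'A'⟩ := hA.refine s' hs'O
  have hcoef : ∀ i, (minpoly K w).coeff i ∈ A' := forall_coeff_minpoly_mem_of_subset w A' hs'A'
  exact ⟨A', hAA', hA', hcoef,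
    mem_nrIn_map_of_forall_coeff_minpoly_mem (Algebra.IsIntegral.isIntegral w) A' hcoef⟩

end Refinement

end Literature.AlgebraicGeometry.Resolution

end
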